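import Mathlib
import HarnessLib
import Summits.QuantumFields.YangMills.Theses.PencilRigidity
import Summits.QuantumFields.YangMills.Theorems.PencilRigidityCurvatureKernelBoundOffDiagonalExtensionFlat
import Summits.QuantumFields.YangMills.Theorems.PencilRigidityCurvatureKernelBoundOffDiagonalExtensionCutoff

/-!
# `CurvatureKernelBound` — stub A4 `OffDiagonalExtension`: kernels extend from `C_c^∞` off the diagonal to `⁰𝒮`

File 3 of stub `OffDiagonalExtension` (crux `stmt-QuantumFields-11687`, line
`sixteen-charts-analytic-kernel`).  Pure analysis on `(ℝ⁴)²`: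

* `exists_cutoff_approx`: compactly supported Schwartz approximants `Φⱼ = θⱼ F`, supported off the
  diagonal, `0 ≤ θⱼ ≤ 1`, `θⱼ → 1` off the diagonal, `Φⱼ → F` in `𝓢`;
* `OffDiagonalExtension` (registered stub): if a continuous functional `T` on `𝓢((ℝ⁴)², ℂ)` is
  integration against `K(x₀ - x₁)` (`K` continuous off `0`, polynomially bounded at `0` and `∞`) on
  compactly supported test functions supported off the diagonal, then `T F = ∫ K(x₀ - x₁) F(x) dx`
  with absolutely integrable integrand for every `F ∈ ⁰𝒮` (continuity of `T` along `Φⱼ → F` and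
  dominated convergence).
[folklore]
-/

noncomputable section

open scoped SchwartzMap ContDiff Topology
open Set MeasureTheory Metric Filter
open Literature.MathematicalPhysics.AQFT Literature.MathematicalPhysics.QuantumLattice

namespace Summit.QuantumFields.YangMills.Theorems.CurvatureKernel

/-! ## Compactly supported off-diagonal approximants -/

/-- **Cut-off approximants.** For `F ∈ ⁰𝒮((E)²)`, `E` finite dimensional, there are Schwartz
functions `Φⱼ = θⱼ F` with compact support off the diagonal, `0 ≤ θⱼ ≤ 1`, `θⱼ(x) = 1` eventually
for every `x` off the diagonal, and `Φⱼ → F` in the Schwartz topology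
(`θⱼ(x) = (1 - b((j+1)(x₀ - x₁))) b'(x/(j+1))` with bumps `b`, `b'`). [folklore] -/
theorem exists_cutoff_approx {E : Type*} [NormedAddCommGroup E] [NormedSpace ℝ E]
    [FiniteDimensional ℝ E] (F : 𝓢((Fin 2 → E), ℂ)) (hF : IsOffDiagonal F) :
    ∃ (Φ : ℕ → 𝓢((Fin 2 → E), ℂ)) (θ : ℕ → (Fin 2 → E) → ℝ),
      (∀ j, HasCompactSupport (Φ j : (Fin 2 → E) → ℂ)) ∧
      (∀ j, tsupport (Φ j : (Fin 2 → E) → ℂ) ⊆ {x | x 0 ≠ x 1}) ∧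
      (∀ j x, Φ j x = θ j x • F x) ∧
      (∀ j x, 0 ≤ θ j x ∧ θ j x ≤ 1) ∧
      (∀ x : Fin 2 → E, x 0 ≠ x 1 → ∀ᶠ j in atTop, θ j x = 1) ∧
      Tendsto Φ atTop (𝓝 F) := by
  let β : ContDiffBump (0 : E) := ⟨1, 2, one_pos, one_lt_two⟩
  let β' : ContDiffBump (0 : Fin 2 → E) := ⟨1, 2, one_pos, one_lt_two⟩
  have hβ2 : ∀ z : E, 2 ≤ ‖z‖ → β z = 0 := fun z hz =>
    β.zero_of_le_dist (by simpa using hz)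
  have hβ1 : ∀ z : E, ‖z‖ ≤ 1 → β z = 1 := fun z hz =>
    β.one_of_mem_closedBall (by simpa using hz)
  have hβ'2 : ∀ z : Fin 2 → E, 2 ≤ ‖z‖ → β' z = 0 := fun z hz =>
    β'.zero_of_le_dist (by simpa using hz)
  have hβ'1 : ∀ z : Fin 2 → E, ‖z‖ ≤ 1 → β' z = 1 := fun z hz =>
    β'.one_of_mem_closedBall (by simpa using hz)
  set ε : ℕ → ℝ := fun j => ((j : ℝ) + 1)⁻¹ with hε
  have hεpos : ∀ j, 0 < ε j := fun j => by positivity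
  have hε1 : ∀ j, ε j ≤ 1 := fun j =>
    inv_le_one_of_one_le₀ (by linarith [(j.cast_nonneg : (0 : ℝ) ≤ j)])
  set θ : ℕ → (Fin 2 → E) → ℝ :=
    fun j y => (1 - β ((ε j)⁻¹ • (y 0 - y 1))) * β' (ε j • y) with hθ
  have hθs : ∀ j, ContDiff ℝ ∞ (fun y => θ j y • F y) := by
    intro j
    have hθj : ContDiff ℝ ∞ (θ j) :=
      (contDiff_const.sub (β.contDiff.comp
        (((contDiff_apply ℝ E 0).sub (contDiff_apply ℝ E 1)).const_smul _))).mul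
        (β'.contDiff.comp (contDiff_id.const_smul _))
    exact hθj.smul (F.smooth ⊤)
  have hθc : ∀ j, HasCompactSupport (fun y => θ j y • F y) := by
    intro j
    refine HasCompactSupport.intro (isCompact_closedBall (0 : Fin 2 → E) (2 * (ε j)⁻¹))
      fun y hy => ?_
    have hy' : 2 * (ε j)⁻¹ < ‖y‖ := by simpa [dist_zero_right] using hy
    have h0 : β' (ε j • y) = 0 := hβ'2 _ (by
      rw [norm_smul, Real.norm_of_nonneg (hεpos j).le]
      calc (2 : ℝ) = ε j * (2 * (ε j)⁻¹) := by
            rw [mul_comm, mul_assoc, inv_mul_cancel₀ (hεpos j).ne', mul_one]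
        _ ≤ ε j * ‖y‖ := by gcongr)
    simp [hθ, h0]
  have hθ01 : ∀ j x, 0 ≤ θ j x ∧ θ j x ≤ 1 := by
    intro j x
    have h1 : 0 ≤ 1 - β ((ε j)⁻¹ • (x 0 - x 1)) := sub_nonneg.2 β.le_one
    have h2 : 1 - β ((ε j)⁻¹ • (x 0 - x 1)) ≤ 1 := sub_le_self _ β.nonneg
    exact ⟨mul_nonneg h1 β'.nonneg, mul_le_one₀ h2 β'.nonneg β'.le_one⟩
  refine ⟨fun j => (hθc j).toSchwartzMap (hθs j), θ, fun j => hθc j, ?_, fun j x => rfl, hθ01,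
    ?_, ?_⟩
  · intro j
    have hcl : IsClosed {x : Fin 2 → E | ε j ≤ ‖x 0 - x 1‖} :=
      isClosed_le continuous_const ((continuous_apply 0).sub (continuous_apply 1)).norm
    refine (closure_minimal ?_ hcl).trans ?_
    · intro y hy
      by_contra hlt
      simp only [mem_setOf_eq, not_le] at hlt
      apply hy
      have h1 : β ((ε j)⁻¹ • (y 0 - y 1)) = 1 := hβ1 _ (by
        rw [norm_smul, Real.norm_of_nonneg (by positivity)]
        calc (ε j)⁻¹ * ‖y 0 - y 1‖ ≤ (ε j)⁻¹ * ε j := by gcongr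
          _ = 1 := inv_mul_cancel₀ (hεpos j).ne')
      show θ j y • F y = 0
      simp [hθ, h1]
    · intro y hy h01
      rw [mem_setOf_eq, h01, sub_self, norm_zero] at hy
      exact absurd hy (not_le.2 (hεpos j))
  · intro x hx
    have hξ : 0 < ‖x 0 - x 1‖ := norm_pos_iff.2 (sub_ne_zero.2 hx)
    have hev : ∀ᶠ j : ℕ in atTop, max (2 / ‖x 0 - x 1‖) ‖x‖ ≤ (j : ℝ) :=
      tendsto_natCast_atTop_atTop.eventually_ge_atTop _
    filter_upwards [hev] with j hj
    have hj1 : 2 / ‖x 0 - x 1‖ ≤ (j : ℝ) + 1 := by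
      linarith [le_max_left (2 / ‖x 0 - x 1‖) ‖x‖]
    have hj2 : ‖x‖ ≤ (j : ℝ) + 1 := by linarith [le_max_right (2 / ‖x 0 - x 1‖) ‖x‖]
    have hb0 : β ((ε j)⁻¹ • (x 0 - x 1)) = 0 := hβ2 _ (by
      rw [norm_smul, Real.norm_of_nonneg (by positivity), hε]
      dsimp only
      rw [inv_inv]
      rw [div_le_iff₀ hξ] at hj1
      linarith)
    have hb1 : β' (ε j • x) = 1 := hβ'1 _ (by
      rw [norm_smul, Real.norm_of_nonneg (hεpos j).le]
      calc ε j * ‖x‖ ≤ ε j * ((j : ℝ) + 1) := by gcongr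
        _ = 1 := inv_mul_cancel₀ (by positivity))
    simp [hθ, hb0, hb1]
  · refine ((schwartz_withSeminorms ℂ (Fin 2 → E) ℂ).tendsto_nhds_atTop _ _).2 fun i δ hδ => ?_
    obtain ⟨C, hC0, hC⟩ := cutoff_error_estimate β.contDiff β.hasCompactSupport hβ2 β'.contDiff
      β'.hasCompactSupport hβ'1 F hF i.1 i.2
    obtain ⟨j₀, hj₀⟩ := exists_nat_gt (C / δ)
    refine ⟨j₀, fun j hj => ?_⟩
    have hεj : C * ε j < δ := by
      rw [hε]
      dsimp only
      rw [← div_eq_mul_inv, div_lt_iff₀ (by positivity)]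
      rw [div_lt_iff₀ hδ] at hj₀
      calc C < (j₀ : ℝ) * δ := hj₀
        _ ≤ ((j : ℝ) + 1) * δ := by
            gcongr
            exact_mod_cast Nat.le_succ_of_le hj
        _ = δ * ((j : ℝ) + 1) := mul_comm _ _
    refine lt_of_le_of_lt ?_ hεj
    change SchwartzMap.seminorm ℂ i.1 i.2 ((hθc j).toSchwartzMap (hθs j) - F) ≤ C * ε j
    rw [← neg_sub, map_neg_eq_map]
    refine SchwartzMap.seminorm_le_bound ℂ i.1 i.2 _ (by positivity) fun x => ?_
    have hcoe : ((F - (hθc j).toSchwartzMap (hθs j) : 𝓢((Fin 2 → E), ℂ)) : (Fin 2 → E) → ℂ) =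
        fun y => (1 - (1 - β ((ε j)⁻¹ • (y 0 - y 1))) * β' (ε j • y)) • F y := by
      funext y
      show F y - θ j y • F y = _
      rw [sub_smul, one_smul]
    rw [hcoe]
    exact hC (ε j) (hεpos j) (hε1 j) x

/-! ## The stub -/

/-- **Stub `OffDiagonalExtension` (A4).** Let `T` be a continuous functional on `𝓢((ℝ⁴)², ℂ)` and
`K` continuous on `ℝ⁴ ∖ 0` with `‖K ξ‖ ≤ A (‖ξ‖ᵖ + ‖ξ‖⁻ᵖ)`, and suppose `T F = ∫ K(x₀ - x₁) F(x) dx`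
(integrable integrand) for every compactly supported `F` supported off the diagonal.  Then the same
holds for every `F ∈ ⁰𝒮`: the integrand is integrable by flatness (file 1); with the approximants
`Φⱼ = θⱼ F → F` in `𝓢` of `exists_cutoff_approx`, `T Φⱼ → T F` by continuity and
`∫ K Φⱼ = ∫ θⱼ K F → ∫ K F` by dominated convergence (`|θⱼ| ≤ 1`, `θⱼ → 1` off the diagonal, and
the integrand vanishes on the diagonal). [folklore] -/
theorem OffDiagonalExtension : open Literature.MathematicalPhysics.QuantumLattice Literature.MathematicalPhysics.AQFT Literature.MathematicalPhysics.QuantumFieldTheory in ∀ (T : SchwartzMap (Fin 2 → (EuclideanSpace ℝ (Fin 4))) ℂ →L[ℂ] ℂ) (K : (EuclideanSpace ℝ (Fin 4)) → ℂ), ContinuousOn K {x : (EuclideanSpace ℝ (Fin 4)) | x ≠ 0} → (∃ (A : ℝ) (p : ℕ), ∀ x : (EuclideanSpace ℝ (Fin 4)), x ≠ 0 → ‖K x‖ ≤ A * (‖x‖ ^ p + ‖x‖⁻¹ ^ p)) → (∀ F : SchwartzMap (Fin 2 → (EuclideanSpace ℝ (Fin 4))) ℂ, HasCompactSupport (F :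 (Fin 2 → (EuclideanSpace ℝ (Fin 4))) → ℂ) → tsupport (F : (Fin 2 → (EuclideanSpace ℝ (Fin 4))) → ℂ) ⊆ {x : Fin 2 → (EuclideanSpace ℝ (Fin 4)) | x 0 ≠ x 1} → MeasureTheory.Integrable (fun x : Fin 2 → (EuclideanSpace ℝ (Fin 4)) => K (x 0 - x 1) * F x) ∧ T F = ∫ x : Fin 2 → (EuclideanSpace ℝ (Fin 4)), K (x 0 - x 1) * F x) → ∀ F : SchwartzMap (Fin 2 → (EuclideanSpace ℝ (Fin 4))) ℂ, IsOffDiagonal F → MeasureTheory.Integrable (fun x : Fin 2 → (EuclideanSpace ℝ (Fin 4)) => K (x 0 - x 1) * F x) ∧ T F = ∫ x : Fin 2 → (EuclideanSpace ℝ (Fin 4)), K (x 0 - x 1) * F x := by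
  intro T K hKc hK hrep F hF
  obtain ⟨A, p, hAp⟩ := hK
  have hint := integrable_kernel_mul_of_isOffDiagonal K hKc A p hAp F hF
  refine ⟨hint, ?_⟩
  obtain ⟨Φ, θ, hΦc, hΦsupp, hΦθ, hθ01, hθ1, hΦlim⟩ := exists_cutoff_approx F hF
  have hT : Tendsto (fun j => T (Φ j)) atTop (𝓝 (T F)) := (T.continuous.tendsto F).comp hΦlim
  have hrepj : ∀ j, Integrable (fun x : Fin 2 → EuclideanSpace ℝ (Fin 4) => K (x 0 - x 1) * Φ j x) ∧
      T (Φ j) = ∫ x : Fin 2 → EuclideanSpace ℝ (Fin 4), K (x 0 - x 1) * Φ j x :=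
    fun j => hrep (Φ j) (hΦc j) (hΦsupp j)
  have hI : Tendsto (fun j => ∫ x : Fin 2 → EuclideanSpace ℝ (Fin 4), K (x 0 - x 1) * Φ j x) atTop
      (𝓝 (∫ x : Fin 2 → EuclideanSpace ℝ (Fin 4), K (x 0 - x 1) * F x)) := by
    refine tendsto_integral_of_dominated_convergence (fun x => ‖K (x 0 - x 1) * F x‖)
      (fun j => (hrepj j).1.aestronglyMeasurable) hint.norm (fun j => Eventually.of_forall fun x => ?_)
      (Eventually.of_forall fun x => ?_)
    · rw [hΦθ j x, Complex.real_smul, ← mul_assoc, mul_comm (K _), mul_assoc, norm_mul,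
        Complex.norm_real, Real.norm_of_nonneg (hθ01 j x).1]
      exact mul_le_of_le_one_left (norm_nonneg _) (hθ01 j x).2
    · by_cases hx : x 0 = x 1
      · have hxc : x ∈ coincidenceLocus 2 (EuclideanSpace ℝ (Fin 4)) := ⟨0, 1, by decide, hx⟩
        have h0 : F x = 0 := hF.apply_eq_zero hxc
        simp only [hΦθ, h0, smul_zero, mul_zero]
        exact tendsto_const_nhds
      · refine (tendsto_const_nhds (x := K (x 0 - x 1) * F x)).congr' ?_
        filter_upwards [hθ1 x hx] with j hj
        rw [hΦθ j x, hj, one_smul]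
  have hT' : Tendsto (fun j => T (Φ j)) atTop
      (𝓝 (∫ x : Fin 2 → EuclideanSpace ℝ (Fin 4), K (x 0 - x 1) * F x)) :=
    hI.congr fun j => (hrepj j).2.symm
  exact tendsto_nhds_unique hT hT'

end Summit.QuantumFields.YangMills.Theorems.CurvatureKernel

end
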